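import Literature.NumberTheory.Automorphic.ArchInnerFormCartanChart   -- ★ PART 2a: `lineOf`, `boostStd`, `gprimeCptGL`, `gprimeSplitGL` (+ ★ `ArchDiagonalTorus`: `archPiEquivCM`, `circleDiagonal_mem_archLocal_diagonal`)
import HarnessLib

/-!
# The Cartan atlas of the inner form `G′_∞ = U(diag α)(L⁺ ⊗ ℝ)`: the torus families `gprimeTorus α S′ c` indexed by the split place-set `S′`
# ((T-ATLAS) PART 2b — LH3-plan (g2) frame ruling «EXPLICIT BOOST» 2026-09-02T05:28:27Z, PACK-SPEC v1 §1; Rogawski 1990 §3.6; Knapp 1986 V §3; Shelstad 1979 §4)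

Topic `NumberTheory/Automorphic`; namespace `Literature.NumberTheory.Automorphic.UnitaryGroup`.  DEFINITIONS WITH BODIES `boostEig`, `cayB`, `formRe`, `formSign`,
`splitChartPlaces`, `gprimeBlock`, **`gprimeTorus`** + theorems (no instance, no notation, no axiom, no `sorry`, no `Classical.choose` in a definition).  Cell
`pub/hodgecm-mathlib`, crux H413 (`stmt-HodgeConjecture-24833`), F0∕P3c line LH3, DIRECT ROAD of `stub_N9` (D2′-SPEC §1, PACK-SPEC v1 §1: `chartTorusG`, `chartOrbG`, `orbFamG`,
`transfFam` all read `gprimeTorus`); seat LH3-p03 (g2).  HOUSE FRAME (D2′-SPEC): DIAGONAL `H′ = diagonal α`, `α i ≠ 0`, `σ_w(α i)` real; signs `s w i = sgn (σ_w α_i).re`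
(= `formSign L α w i`).  Count-neutral chart file (the G′-side mirror of ★ `ArchEndoscopicCartanAtlas` = PART 1).

THE MATHEMATICS.  At a complex place `w` of the CM field `L`, `G′_w = U(σ_w diag α)(ℂ) = U(diag a)(ℂ)` with the REAL diagonal form `a = formRe L α w` (`a_i = re σ_w α_i`).
In the sign-adapted slot order `τ = lineOf (formSign L α w)` (slot `0 ↦` first even-sign line `p w`, slot `1 ↦` second even line, slot `2 ↦` odd line — PART 2a, (COORD)
convention) the chart of type `S′` has the place component (`gprimeBlock`)
* `w ∈ S′` (and `w` a split-chart place: form real, plane `(τ 0, τ 2)` hyperbolic — `splitChartPlaces`, automatic at an indefinite place of the house frame,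
  `mem_splitChartPlaces_of_frame`): the boost `gprimeSplitGL τ a (c w)` — `x_w = c w 0` on the plane `(p w, odd w)`, `e^{i c w 1}` on the second even line, phase `θ_w = c w 2`;
* otherwise: the unit diagonal `gprimeCptGL τ (c w)` — angle `c w k` on the line `τ k`;
and **`gprimeTorus L α S′ c ∈ G′_∞`** is assembled through ★ `archPiEquivCM` (as ★ `endoTorus`).  The definition is TOTAL (the `dite` falls back to the compact chart where
the split chart would not lie in `G′_w`); every READING is under the house frame, where `gprimeBlock` IS the boost at `w ∈ S′` (`coe_gprimeBlock_of_mem`).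
EIGEN-FACTORISATION (serves regularity — sibling file — and the (PARTNER) conjugation of F0P2-p02): for `b₀ b₂ < 0`,
`boostStd b c · cayB b = cayB b · diag(e^{x+iθ}, e^{iφ}, e^{−x+iθ})`, `cayB b = (r, 0, r; 0, 1, 0; 1, 0, −1)`, `det cayB b = −2r ≠ 0` (`boostStd_eq_conj_diagonal`,
`charpoly_boostStd`).  WALL: at `x = 0` the boost is `diag(e^{iθ}, e^{iφ}, e^{iθ})` (`boostStd_zero`), so at a wall `c w 0 = c w 2` of a compact chart place `w ∉ S′`
that is a split-chart place, `gprimeTorus S′ c = gprimeTorus (insert w S′) (update c w (0, c w 1, c w 0))` (`gprimeTorus_of_wall`) — the shape of ★ `endoTorus_of_wall` ∕ (COORD) ★ `cayPt`.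
* §1 `boostEig`, `cayB`, `det_cayB`, `sqrt_ratio_ne_zero`, `det_cayB_ne_zero`, `boostStd_mul_cayB`, `boostStd_eq_conj_diagonal`, `charpoly_boostStd`, `boostEig_add`,
  `boostStd_add` (one-parameter-group law), `boostStd_zero_eq_one`, `boostStd_zero`, `gprimeSplitMatrix_zero`, `charpoly_gprimeSplitMatrix`, `charpoly_coe_gprimeCptGL`,
  `gprimeCptGL_add∕_zero`, `gprimeSplitGL_add∕_zero`;
* §2 `formRe`, `formSign`, `diagonal_map_embedding_eq_of_real`, `formRe_ne_zero`, `splitChartPlaces`, `mem_splitChartPlaces_of_frame`, `gprimeCptGL_mem_archLocal`,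
  `gprimeSplitGL_mem_archLocal`, **`gprimeBlock`**, `coe_gprimeBlock_of_not_mem`, `coe_gprimeBlock_of_mem`, `coe_gprimeBlock_of_not_mem_splitChartPlaces`;
* §3 **`gprimeTorus`**, `archPiEquivCM_gprimeTorus`, `gprimeTorus_congr`, `continuous_gprimeTorus`, **`gprimeTorus_add`**, `gprimeTorus_zero`, `gprimeTorus_neg`,
  `gprimeTorus_comm` (the chart torus `{gprimeTorus α S′ c | c}` = `chartTorusG S′` of PACK-SPEC §1 is the range of a homomorphism), **`gprimeTorus_of_wall`**.
HONEST LABEL: HC_CM is proved only modulo the 7 printed citations (2 remaining: hLiu418 = `stmt-HodgeConjecture-24832`, h413 = `stmt-HodgeConjecture-24833`) until rung 0 closes (+0∕+0).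

## References
* [Rogawski1990] J. D. Rogawski, *Automorphic Representations of Unitary Groups in Three Variables*, Ann. of Math. Stud. 123 (1990), §3.6 p. 31, §4.9 p. 54, §4.3 p. 42.
* [Knapp1986] A. W. Knapp, *Representation Theory of Semisimple Groups* (1986), Ch. V §3 (Cartan subgroups of `SU(2,1)`; the boost and its eigenvectors).
* [Shelstad1979] D. Shelstad, *Characters and inner forms of a quasi-split group over ℝ*, Compositio Math. 39 (1979), §4 pp. 22–25 (Cayley transform at a noncompact wall).
-/

set_option autoImplicit false

noncomputable section

open NumberField NumberField.InfinitePlace Matrix Complex Polynomial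
open scoped MatrixGroups Matrix ComplexConjugate Real Classical

namespace Literature.NumberTheory.Automorphic.UnitaryGroup

/-! ## §1 Standard position: eigen-factorisation of the boost, the `x = 0` edge -/

section Standard

/-- **The eigenvalue triple of the boost** in slot order: `(e^{x+iθ}, e^{iφ}, e^{−x+iθ})`, `x = c 0`, `φ = c 1`, `θ = c 2`. [cite: Knapp1986, Ch. V §3] -/
def boostEig (c : Fin 3 → ℝ) : Fin 3 → ℂ :=
  ![Complex.exp ((c 0 : ℂ) + (c 2 : ℂ) * I), Complex.exp ((c 1 : ℂ) * I), Complex.exp (-(c 0 : ℂ) + (c 2 : ℂ) * I)]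

/-- **The eigenvector matrix of the boost** (columns `(r, 0, 1)`, `(0, 1, 0)`, `(r, 0, −1)`, `r = √(−b₂∕b₀)`), independent of `c`. [cite: Knapp1986, Ch. V §3] -/
def cayB (b : Fin 3 → ℝ) : Matrix (Fin 3) (Fin 3) ℂ :=
  !![(Real.sqrt (-b 2 / b 0) : ℂ), 0, (Real.sqrt (-b 2 / b 0) : ℂ); 0, 1, 0; 1, 0, -1]

/-- `det cayB b = −2r`. [cite: Knapp1986, Ch. V §3] -/
theorem det_cayB (b : Fin 3 → ℝ) : (cayB b).det = -2 * (Real.sqrt (-b 2 / b 0) : ℂ) := by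
  simp [Matrix.det_fin_three, cayB]
  ring

/-- `r = √(−b₂∕b₀) ≠ 0` when `b₀ b₂ < 0`. [cite: Knapp1986, Ch. V §3] -/
theorem sqrt_ratio_ne_zero {b : Fin 3 → ℝ} (hb : b 0 * b 2 < 0) : Real.sqrt (-b 2 / b 0) ≠ 0 := by
  have hb0 : b 0 ≠ 0 := fun h => by rw [h, zero_mul] at hb; exact lt_irrefl _ hb
  have hq : 0 < -b 2 / b 0 := by
    rcases lt_or_gt_of_ne hb0 with h | h
    · have : 0 < b 2 := by nlinarith
      exact div_pos_of_neg_of_neg (by linarith) h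
    · have : b 2 < 0 := by nlinarith
      exact div_pos (by linarith) h
  exact (Real.sqrt_pos.2 hq).ne'

/-- `det cayB b ≠ 0` when `b₀ b₂ < 0`. [cite: Knapp1986, Ch. V §3] -/
theorem det_cayB_ne_zero {b : Fin 3 → ℝ} (hb : b 0 * b 2 < 0) : (cayB b).det ≠ 0 := by
  rw [det_cayB]
  exact mul_ne_zero (by norm_num) (Complex.ofReal_ne_zero.2 (sqrt_ratio_ne_zero hb))

/-- **`B · P = P · D`**: the columns of `cayB b` are eigenvectors of the boost with eigenvalues `boostEig c` (`cosh x ± sinh x = e^{±x}`, `r⁻¹ r = 1`). [cite: Knapp1986, Ch. V §3] -/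
theorem boostStd_mul_cayB {b : Fin 3 → ℝ} (hb : b 0 * b 2 < 0) (c : Fin 3 → ℝ) :
    boostStd b c * cayB b = cayB b * Matrix.diagonal (boostEig c) := by
  set r : ℝ := Real.sqrt (-b 2 / b 0) with hr
  have hr0 : r ≠ 0 := sqrt_ratio_ne_zero hb
  have hrr : ((r : ℂ))⁻¹ * (r : ℂ) = 1 := inv_mul_cancel₀ (Complex.ofReal_ne_zero.2 hr0)
  have hsum : (Real.cosh (c 0) : ℂ) + (Real.sinh (c 0) : ℂ) = Complex.exp (c 0 : ℂ) := by
    rw [← Complex.ofReal_exp]; exact_mod_cast Real.cosh_add_sinh (c 0)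
  have hdiff : (Real.cosh (c 0) : ℂ) - (Real.sinh (c 0) : ℂ) = Complex.exp (-(c 0 : ℂ)) := by
    rw [← Complex.ofReal_neg, ← Complex.ofReal_exp]; exact_mod_cast Real.cosh_sub_sinh (c 0)
  have h0 : Complex.exp ((c 0 : ℂ) + (c 2 : ℂ) * I) = Complex.exp (c 0 : ℂ) * Complex.exp ((c 2 : ℂ) * I) := Complex.exp_add _ _
  have h2 : Complex.exp (-(c 0 : ℂ) + (c 2 : ℂ) * I) = Complex.exp (-(c 0 : ℂ)) * Complex.exp ((c 2 : ℂ) * I) := Complex.exp_add _ _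
  ext i j
  fin_cases i <;> fin_cases j <;>
    simp [boostStd, cayB, boostEig, Matrix.mul_apply, Matrix.diagonal_apply, Fin.sum_univ_three, ← hr,
      -Complex.ofReal_cosh, -Complex.ofReal_sinh]
  · linear_combination Complex.exp ((c 2 : ℂ) * I) * (r : ℂ) * hsum - (r : ℂ) * h0
  · linear_combination Complex.exp ((c 2 : ℂ) * I) * (r : ℂ) * hdiff - (r : ℂ) * h2
  · linear_combination Complex.exp ((c 2 : ℂ) * I) * (Real.sinh (c 0) : ℂ) * hrr + Complex.exp ((c 2 : ℂ) * I) * hsum - h0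
  · linear_combination Complex.exp ((c 2 : ℂ) * I) * (Real.sinh (c 0) : ℂ) * hrr - Complex.exp ((c 2 : ℂ) * I) * hdiff + h2

/-- **`B = P · D · P⁻¹`** — the boost is `GL₃(ℂ)`-conjugate to `diag(e^{x+iθ}, e^{iφ}, e^{−x+iθ})` by the `c`-INDEPENDENT matrix `cayB b`. [cite: Knapp1986, Ch. V §3] -/
theorem boostStd_eq_conj_diagonal {b : Fin 3 → ℝ} (hb : b 0 * b 2 < 0) (c : Fin 3 → ℝ) :
    boostStd b c = cayB b * Matrix.diagonal (boostEig c) * (cayB b)⁻¹ := by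
  have hu : IsUnit (cayB b).det := (det_cayB_ne_zero hb).isUnit
  calc boostStd b c = boostStd b c * cayB b * (cayB b)⁻¹ := by rw [Matrix.mul_assoc, Matrix.mul_nonsing_inv _ hu, Matrix.mul_one]
    _ = cayB b * Matrix.diagonal (boostEig c) * (cayB b)⁻¹ := by rw [boostStd_mul_cayB hb]

/-- **`charpoly (boostStd b c) = ∏_i (X − λ_i)`**, `λ = boostEig c`, for `b₀ b₂ < 0`. [cite: Knapp1986, Ch. V §3] [cite: Rogawski1990, §4.3 p. 42] -/
theorem charpoly_boostStd {b : Fin 3 → ℝ} (hb : b 0 * b 2 < 0) (c : Fin 3 → ℝ) :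
    (boostStd b c).charpoly = ∏ i : Fin 3, (X - Polynomial.C (boostEig c i)) := by
  have hu : IsUnit (cayB b).det := (det_cayB_ne_zero hb).isUnit
  have h : boostStd b c = ((Matrix.nonsingInvUnit (cayB b) hu : (Matrix (Fin 3) (Fin 3) ℂ)ˣ) : Matrix (Fin 3) (Fin 3) ℂ) * Matrix.diagonal (boostEig c) *
      (((Matrix.nonsingInvUnit (cayB b) hu : (Matrix (Fin 3) (Fin 3) ℂ)ˣ) : Matrix (Fin 3) (Fin 3) ℂ))⁻¹ := boostStd_eq_conj_diagonal hb c
  rw [h, Matrix.charpoly_units_conj, Matrix.charpoly_diagonal]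

/-- **The `x = 0` edge of the boost is the unit diagonal `diag(e^{iθ}, e^{iφ}, e^{iθ})`** (no hypothesis on `b`). [cite: Shelstad1979, §4 p. 25] -/
theorem boostStd_zero (b : Fin 3 → ℝ) (φ θ : ℝ) :
    boostStd b ![0, φ, θ] = Matrix.diagonal ![Complex.exp ((θ : ℂ) * I), Complex.exp ((φ : ℂ) * I), Complex.exp ((θ : ℂ) * I)] := by
  ext i j
  fin_cases i <;> fin_cases j <;> simp [boostStd, Matrix.diagonal]

/-- The eigenvalue triple is additive-to-multiplicative in `c`. [cite: Knapp1986, Ch. V §3] -/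
theorem boostEig_add (c c' : Fin 3 → ℝ) : boostEig (c + c') = fun i => boostEig c i * boostEig c' i := by
  funext i
  fin_cases i <;> simp [boostEig, ← Complex.exp_add] <;> ring_nf

/-- **The boost is a one-parameter-group law in `c`**: `B(b; c + c′) = B(b; c) · B(b; c′)` for `b₀ b₂ < 0` (common eigenbasis `cayB b`). [cite: Knapp1986, Ch. V §3] -/
theorem boostStd_add {b : Fin 3 → ℝ} (hb : b 0 * b 2 < 0) (c c' : Fin 3 → ℝ) : boostStd b (c + c') = boostStd b c * boostStd b c' := by
  have hu : IsUnit (cayB b).det := (det_cayB_ne_zero hb).isUnit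
  rw [boostStd_eq_conj_diagonal hb, boostStd_eq_conj_diagonal hb, boostStd_eq_conj_diagonal hb, boostEig_add]
  calc cayB b * Matrix.diagonal (fun i => boostEig c i * boostEig c' i) * (cayB b)⁻¹
      = cayB b * (Matrix.diagonal (boostEig c) * ((cayB b)⁻¹ * cayB b) * Matrix.diagonal (boostEig c')) * (cayB b)⁻¹ := by
        rw [Matrix.nonsing_inv_mul _ hu, Matrix.mul_one, Matrix.diagonal_mul_diagonal]
    _ = cayB b * Matrix.diagonal (boostEig c) * (cayB b)⁻¹ * (cayB b * Matrix.diagonal (boostEig c') * (cayB b)⁻¹) := by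
        simp only [Matrix.mul_assoc]

/-- `B(b; 0) = 1` (every `b`). [cite: Knapp1986, Ch. V §3] -/
theorem boostStd_zero_eq_one (b : Fin 3 → ℝ) : boostStd b 0 = 1 := by
  have h0 : (0 : Fin 3 → ℝ) = ![0, 0, 0] := by funext k; fin_cases k <;> rfl
  rw [h0, boostStd_zero]
  ext i j
  fin_cases i <;> fin_cases j <;> simp

variable (τ : Fin 3 ≃ Fin 3) (a : Fin 3 → ℝ)

/-- **The `x = 0` edge of the split place chart is the compact place chart with equal angles on the plane**: `gprimeSplitMatrix τ a (0, φ, θ) = gprimeCptGL τ (θ, φ, θ)`.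
[cite: Shelstad1979, §4 p. 25] -/
theorem gprimeSplitMatrix_zero (φ θ : ℝ) :
    gprimeSplitMatrix τ a ![0, φ, θ] = ((gprimeCptGL τ ![θ, φ, θ] : GL (Fin 3) ℂ) : Matrix (Fin 3) (Fin 3) ℂ) := by
  rw [gprimeSplitMatrix, boostStd_zero, Matrix.submatrix_diagonal_equiv, coe_gprimeCptGL]
  congr 1
  funext ℓ
  simp only [Function.comp_apply]
  generalize τ.symm ℓ = k
  fin_cases k <;> simp

/-- `charpoly (gprimeSplitMatrix τ a c) = ∏_i (X − λ_i)` (`λ = boostEig c`) when the plane `(τ 0, τ 2)` is hyperbolic (re-indexing preserves `charpoly`).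
[cite: Rogawski1990, §4.3 p. 42] -/
theorem charpoly_gprimeSplitMatrix (h : a (τ 0) * a (τ 2) < 0) (c : Fin 3 → ℝ) :
    (gprimeSplitMatrix τ a c).charpoly = ∏ i : Fin 3, (X - Polynomial.C (boostEig c i)) := by
  rw [gprimeSplitMatrix, ← Matrix.reindex_apply, Matrix.charpoly_reindex]
  exact charpoly_boostStd (b := a ∘ τ) h c

/-- `charpoly (gprimeCptGL τ c) = ∏_i (X − e^{i c_i})`. [cite: Rogawski1990, §4.3 p. 42] -/
theorem charpoly_coe_gprimeCptGL (c : Fin 3 → ℝ) :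
    ((gprimeCptGL τ c : GL (Fin 3) ℂ) : Matrix (Fin 3) (Fin 3) ℂ).charpoly = ∏ i : Fin 3, (X - Polynomial.C (Complex.exp ((c i : ℂ) * I))) := by
  rw [coe_gprimeCptGL, Matrix.charpoly_diagonal]
  exact Fintype.prod_equiv τ.symm _ _ fun ℓ => rfl

/-- The compact place chart is a group law in `c`: `gprimeCptGL τ (c + c′) = gprimeCptGL τ c · gprimeCptGL τ c′` (★ `circleDiagonal` is a `MonoidHom`, `Circle.exp_add`).
[cite: Rogawski1990, §4.9 p. 54] -/
theorem gprimeCptGL_add (c c' : Fin 3 → ℝ) : gprimeCptGL τ (c + c') = gprimeCptGL τ c * gprimeCptGL τ c' := by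
  unfold gprimeCptGL
  rw [← map_mul]
  exact congrArg _ (funext fun ℓ => Circle.exp_add _ _)

/-- `gprimeCptGL τ 0 = 1`. [cite: Rogawski1990, §4.9 p. 54] -/
theorem gprimeCptGL_zero : gprimeCptGL τ 0 = 1 := by
  unfold gprimeCptGL
  have : (fun ℓ : Fin 3 => Circle.exp ((0 : Fin 3 → ℝ) (τ.symm ℓ))) = 1 := by funext ℓ; simp
  rw [this, map_one]

/-- The split place chart is a group law in `c` when its plane is hyperbolic. [cite: Knapp1986, Ch. V §3] -/
theorem gprimeSplitGL_add (h : a (τ 0) * a (τ 2) < 0) (c c' : Fin 3 → ℝ) : gprimeSplitGL τ a (c + c') = gprimeSplitGL τ a c * gprimeSplitGL τ a c' := by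
  refine Matrix.GeneralLinearGroup.ext fun i j => ?_
  rw [Units.val_mul, coe_gprimeSplitGL, coe_gprimeSplitGL, coe_gprimeSplitGL, gprimeSplitMatrix, gprimeSplitMatrix, gprimeSplitMatrix,
    Matrix.submatrix_mul_equiv, ← boostStd_add (b := a ∘ τ) h]

/-- `gprimeSplitGL τ a 0 = 1`. [cite: Knapp1986, Ch. V §3] -/
theorem gprimeSplitGL_zero : gprimeSplitGL τ a 0 = 1 := by
  refine Matrix.GeneralLinearGroup.ext fun i j => ?_
  rw [coe_gprimeSplitGL, gprimeSplitMatrix, boostStd_zero_eq_one, Matrix.submatrix_one_equiv, Units.val_one]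

end Standard

/-! ## §2 Place data of the diagonal frame and the place component `gprimeBlock` -/

section Place

variable (L : Type) [Field L] (α : Fin 3 → L) (w : {w : InfinitePlace L // IsComplex w})

/-- **The real diagonal form at the place `w`**: `a_i = re σ_w(α_i)`. [cite: Rogawski1990, §3.6 p. 31] -/
def formRe : Fin 3 → ℝ := fun i => (w.1.embedding (α i)).re

/-- **The sign pattern at the place `w`**: `s w i = sgn re σ_w(α_i)` (D2′-SPEC; (COORD) ★ `InRegG s`). [cite: Rogawski1990, §3.6 p. 31] -/
def formSign : Fin 3 → SignType := fun i => SignType.sign (formRe L α w i)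

variable {L α w} in
/-- For a real frame `σ_w(diag α) = diag(a)`, `a = formRe L α w` (as complex numbers). [cite: Rogawski1990, §3.6 p. 31] -/
theorem diagonal_map_embedding_eq_of_real (hreal : ∀ i, (w.1.embedding (α i)).im = 0) :
    (Matrix.diagonal α).map w.1.embedding = Matrix.diagonal fun i => ((formRe L α w i : ℝ) : ℂ) := by
  rw [Matrix.diagonal_map (map_zero _)]
  congr 1
  funext i
  exact Complex.ext (by simp [formRe]) (by simp [hreal i])

variable {L α w} in
/-- In the house frame (`α_i ≠ 0`, `σ_w α_i` real) no `a_i` vanishes. [cite: Rogawski1990, §3.6 p. 31] -/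
theorem formRe_ne_zero (hα : ∀ i, α i ≠ 0) (hreal : ∀ i, (w.1.embedding (α i)).im = 0) (i : Fin 3) : formRe L α w i ≠ 0 := by
  intro h
  have he : w.1.embedding (α i) ≠ 0 := (_root_.map_ne_zero _).2 (hα i)
  exact he (Complex.ext (by simpa [formRe] using h) (by simpa using hreal i))

/-- **The split-chart places of the frame**: the places `w` where the form is real and the boost plane `(lineOf s 0, lineOf s 2)` is hyperbolic
(`a (τ 0) · a (τ 2) < 0`) — the condition under which the split chart lies in `G′_w`; every INDEFINITE place of the house frame (`mem_splitChartPlaces_of_frame`), no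
definite one (D2′-SPEC's `W_ind`). [cite: Rogawski1990, §3.6 p. 31] -/
def splitChartPlaces : Set {w : InfinitePlace L // IsComplex w} :=
  {w | (∀ i, (w.1.embedding (α i)).im = 0) ∧ formRe L α w (lineOf (formSign L α w) 0) * formRe L α w (lineOf (formSign L α w) 2) < 0}

variable {L α w} in
/-- An indefinite place of the house frame is a split-chart place (PART 2a `mul_apply_lineOf_neg`). [cite: Rogawski1990, §3.6 p. 31] [cite: Knapp1986, Ch. V §3] -/
theorem mem_splitChartPlaces_of_frame (hα : ∀ i, α i ≠ 0) (hreal : ∀ i, (w.1.embedding (α i)).im = 0)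
    (hind : ¬ (formSign L α w 0 = formSign L α w 1 ∧ formSign L α w 1 = formSign L α w 2)) : w ∈ splitChartPlaces L α :=
  ⟨hreal, mul_apply_lineOf_neg (a := formRe L α w) (formRe_ne_zero hα hreal) hind⟩

/-- The compact place chart lies in `G′_w = U(σ_w diag α)(ℂ)` for every `α` (★ `circleDiagonal_mem_archLocal_diagonal`). [cite: Rogawski1990, §4.9 p. 54] -/
theorem gprimeCptGL_mem_archLocal (τ : Fin 3 ≃ Fin 3) (cw : Fin 3 → ℝ) : gprimeCptGL τ cw ∈ archLocal L 3 (Matrix.diagonal α) w :=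
  circleDiagonal_mem_archLocal_diagonal L 3 α w _

variable {L α w} in
/-- The split place chart lies in `G′_w` at a place where the form is real and the plane `(τ 0, τ 2)` is hyperbolic. [cite: Knapp1986, Ch. V §3] [cite: Rogawski1990, §1.9 p. 8] -/
theorem gprimeSplitGL_mem_archLocal (τ : Fin 3 ≃ Fin 3) (hreal : ∀ i, (w.1.embedding (α i)).im = 0)
    (h : formRe L α w (τ 0) * formRe L α w (τ 2) < 0) (cw : Fin 3 → ℝ) :
    gprimeSplitGL τ (formRe L α w) cw ∈ archLocal L 3 (Matrix.diagonal α) w := by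
  show gprimeSplitGL τ (formRe L α w) cw ∈ unitaryGroupOfForm (starRingEnd ℂ) ((Matrix.diagonal α).map w.1.embedding)
  rw [diagonal_map_embedding_eq_of_real hreal]
  exact gprimeSplitGL_mem_unitaryGroupOfForm_diagonal τ _ h cw

variable (S' : Finset {w : InfinitePlace L // IsComplex w}) (c : {w : InfinitePlace L // IsComplex w} → Fin 3 → ℝ)

/-- **The `G′_w`-component of the chart `S′`**: the boost `gprimeSplitGL (lineOf s) a (c w)` at a split place `w ∈ S′` that is a split-chart place, the unit diagonal
`gprimeCptGL (lineOf s) (c w)` otherwise (`s = formSign L α w`, `a = formRe L α w`). [cite: Rogawski1990, §3.6 p. 31] [cite: Knapp1986, Ch. V §3] -/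
def gprimeBlock : ↥(archLocal L 3 (Matrix.diagonal α) w) :=
  if h : w ∈ S' ∧ w ∈ splitChartPlaces L α then
    ⟨gprimeSplitGL (lineOf (formSign L α w)) (formRe L α w) (c w), gprimeSplitGL_mem_archLocal _ h.2.1 h.2.2 (c w)⟩
  else ⟨gprimeCptGL (lineOf (formSign L α w)) (c w), gprimeCptGL_mem_archLocal L α w _ (c w)⟩

variable {S' w} in
/-- Off `S′` the component is the compact chart. [cite: Rogawski1990, §3.6 p. 31] -/
theorem coe_gprimeBlock_of_not_mem (hw : w ∉ S') :
    ((gprimeBlock L α w S' c : ↥(archLocal L 3 (Matrix.diagonal α) w)) : GL (Fin 3) ℂ) = gprimeCptGL (lineOf (formSign L α w)) (c w) := by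
  unfold gprimeBlock
  rw [dif_neg (fun h => hw h.1)]

variable {S' w} in
/-- At a place that is not a split-chart place the component is the compact chart (whatever `S′`). [cite: Rogawski1990, §3.6 p. 31] -/
theorem coe_gprimeBlock_of_not_mem_splitChartPlaces (hw : ¬ w ∈ splitChartPlaces L α) :
    ((gprimeBlock L α w S' c : ↥(archLocal L 3 (Matrix.diagonal α) w)) : GL (Fin 3) ℂ) = gprimeCptGL (lineOf (formSign L α w)) (c w) := by
  unfold gprimeBlock
  rw [dif_neg (fun h => hw h.2)]

variable {S' w} in
/-- **On `S′`, at a split-chart place, the component is the boost.** [cite: Knapp1986, Ch. V §3] [cite: Rogawski1990, §3.6 p. 31] -/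
theorem coe_gprimeBlock_of_mem (hw : w ∈ S') (hsp : w ∈ splitChartPlaces L α) :
    ((gprimeBlock L α w S' c : ↥(archLocal L 3 (Matrix.diagonal α) w)) : GL (Fin 3) ℂ) = gprimeSplitGL (lineOf (formSign L α w)) (formRe L α w) (c w) := by
  unfold gprimeBlock
  rw [dif_pos ⟨hw, hsp⟩]

end Place

/-! ## §3 The charts `gprimeTorus α S′ c` of `G′_∞` -/

section Charts

variable (L : Type) [Field L] [NumberField L] [IsCMField L] (α : Fin 3 → L)

/-- **THE CHART `gprimeTorus α S′ c ∈ G′_∞ = U(diag α)(L⁺ ⊗ ℝ)`** — the torus family of the Cartan class `S′` (noncompact at `w ∈ S′`) in the common coordinates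
`c : W → Fin 3 → ℝ`, assembled from its place components through ★ `archPiEquivCM`. [cite: Rogawski1990, §3.6 p. 31] [cite: Shelstad1979, §4 p. 22] -/
def gprimeTorus (S' : Finset {w : InfinitePlace L // IsComplex w}) (c : {w : InfinitePlace L // IsComplex w} → Fin 3 → ℝ) :
    ↥(arch (↥(maximalRealSubfield L)) L (IsCMField.complexConj L) 3 (Matrix.diagonal α)) :=
  (archPiEquivCM 3 L (Matrix.diagonal α)).symm fun w => gprimeBlock L α w S' c

variable (S' : Finset {w : InfinitePlace L // IsComplex w}) (c : {w : InfinitePlace L // IsComplex w} → Fin 3 → ℝ) (w : {w : InfinitePlace L // IsComplex w})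

/-- The `G′_w`-component of `gprimeTorus α S′ c` is `gprimeBlock α w S′ c`. [cite: Rogawski1990, §3.6 p. 31] -/
@[simp] theorem archPiEquivCM_gprimeTorus : archPiEquivCM 3 L (Matrix.diagonal α) (gprimeTorus L α S' c) w = gprimeBlock L α w S' c := by
  rw [gprimeTorus, ContinuousMulEquiv.apply_symm_apply]

/-- The chart only reads the coordinates: `gprimeTorus α S′ c = gprimeTorus α S′ c′` if `c w i = c′ w i` for all `w, i`. [cite: Rogawski1990, §3.6 p. 31] -/
theorem gprimeTorus_congr {c c' : {w : InfinitePlace L // IsComplex w} → Fin 3 → ℝ} (h : ∀ w i, c w i = c' w i) :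
    gprimeTorus L α S' c = gprimeTorus L α S' c' := by
  have : c = c' := funext fun w => funext fun i => h w i
  rw [this]

/-- **`gprimeTorus α S′` is continuous in the coordinates** (★ `archPiEquivCM` is a homeomorphism; PART 2a `continuous_gprimeSplitGL ∕ continuous_gprimeCptGL`; the `dite` is on
the fixed data `S′`, `α`). [cite: Rogawski1990, §3.6 p. 31] -/
theorem continuous_gprimeTorus : Continuous (gprimeTorus L α S') := by
  refine (archPiEquivCM 3 L _).symm.continuous.comp (continuous_pi fun w => ?_)
  by_cases h : w ∈ S' ∧ w ∈ splitChartPlaces L α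
  · have e : (fun c : {w : InfinitePlace L // IsComplex w} → Fin 3 → ℝ => gprimeBlock L α w S' c) =
        fun c => ⟨gprimeSplitGL (lineOf (formSign L α w)) (formRe L α w) (c w), gprimeSplitGL_mem_archLocal _ h.2.1 h.2.2 (c w)⟩ := by
      funext c; unfold gprimeBlock; rw [dif_pos h]
    rw [e]
    exact ((continuous_gprimeSplitGL _ _).comp (continuous_apply w)).subtype_mk _
  · have e : (fun c : {w : InfinitePlace L // IsComplex w} → Fin 3 → ℝ => gprimeBlock L α w S' c) =
        fun c => ⟨gprimeCptGL (lineOf (formSign L α w)) (c w), gprimeCptGL_mem_archLocal L α w _ (c w)⟩ := by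
      funext c; unfold gprimeBlock; rw [dif_neg h]
    rw [e]
    exact ((continuous_gprimeCptGL _).comp (continuous_apply w)).subtype_mk _

/-- **`c ↦ gprimeTorus α S′ c` is a group law** (`(W → Fin 3 → ℝ, +) → G′_∞`): so the chart torus `{gprimeTorus α S′ c | c}` of PACK-SPEC §1 (`chartTorusG S′`) is the range
of a homomorphism — a commutative subgroup. [cite: Rogawski1990, §3.6 p. 31] [cite: Knapp1986, Ch. V §3] -/
theorem gprimeTorus_add (c c' : {w : InfinitePlace L // IsComplex w} → Fin 3 → ℝ) :
    gprimeTorus L α S' (c + c') = gprimeTorus L α S' c * gprimeTorus L α S' c' := by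
  unfold gprimeTorus
  rw [← map_mul]
  congr 1
  funext v
  apply Subtype.ext
  rw [Pi.mul_apply, Subgroup.coe_mul]
  show ((gprimeBlock L α v S' (c + c') : ↥(archLocal L 3 (Matrix.diagonal α) v)) : GL (Fin 3) ℂ) =
    ((gprimeBlock L α v S' c : ↥(archLocal L 3 (Matrix.diagonal α) v)) : GL (Fin 3) ℂ) * ((gprimeBlock L α v S' c' : ↥(archLocal L 3 (Matrix.diagonal α) v)) : GL (Fin 3) ℂ)
  by_cases h : v ∈ S' ∧ v ∈ splitChartPlaces L α
  · rw [coe_gprimeBlock_of_mem L α _ h.1 h.2, coe_gprimeBlock_of_mem L α _ h.1 h.2, coe_gprimeBlock_of_mem L α _ h.1 h.2]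
    exact gprimeSplitGL_add _ _ h.2.2 (c v) (c' v)
  · unfold gprimeBlock
    rw [dif_neg h, dif_neg h, dif_neg h]
    exact gprimeCptGL_add _ (c v) (c' v)

/-- `gprimeTorus α S′ 0 = 1`. [cite: Rogawski1990, §3.6 p. 31] -/
theorem gprimeTorus_zero : gprimeTorus L α S' 0 = 1 := by
  unfold gprimeTorus
  rw [← map_one (archPiEquivCM 3 L (Matrix.diagonal α)).symm]
  congr 1
  funext v
  apply Subtype.ext
  rw [Pi.one_apply, Subgroup.coe_one]
  show ((gprimeBlock L α v S' 0 : ↥(archLocal L 3 (Matrix.diagonal α) v)) : GL (Fin 3) ℂ) = 1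
  by_cases h : v ∈ S' ∧ v ∈ splitChartPlaces L α
  · rw [coe_gprimeBlock_of_mem L α _ h.1 h.2]
    exact gprimeSplitGL_zero _ _
  · unfold gprimeBlock
    rw [dif_neg h]
    exact gprimeCptGL_zero (lineOf (formSign L α v))

/-- The inverse chart point: `gprimeTorus α S′ (−c) = (gprimeTorus α S′ c)⁻¹`. [cite: Rogawski1990, §3.6 p. 31] -/
theorem gprimeTorus_neg (c : {w : InfinitePlace L // IsComplex w} → Fin 3 → ℝ) : gprimeTorus L α S' (-c) = (gprimeTorus L α S' c)⁻¹ := by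
  rw [eq_inv_iff_mul_eq_one, ← gprimeTorus_add, neg_add_cancel, gprimeTorus_zero]

/-- Chart points commute. [cite: Rogawski1990, §3.6 p. 31] -/
theorem gprimeTorus_comm (c c' : {w : InfinitePlace L // IsComplex w} → Fin 3 → ℝ) :
    gprimeTorus L α S' c * gprimeTorus L α S' c' = gprimeTorus L α S' c' * gprimeTorus L α S' c := by
  rw [← gprimeTorus_add, ← gprimeTorus_add, add_comm]

variable {S' c w} in
/-- **WALL COMPATIBILITY (the Cayley point on `G′`).**  At the noncompact wall `c w 0 = c w 2` of the chart `S′` at a compact place `w ∉ S′` that is a split-chart place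
(the angles on the hyperbolic plane `(p w, odd w)` coincide), the compact component is the `x_w = 0` edge of the split chart: `gprimeTorus α S′ c = gprimeTorus α (insert w S′) c′`
with `c′ w = (0, c w 1, c w 0)` and `c′ = c` off `w` — the literal analogue of ★ `endoTorus_of_wall`, and (COORD) ★ `cayPt` on the wall. [cite: Shelstad1979, §4 pp. 22–25]
[cite: Rogawski1990, §3.6 p. 31] -/
theorem gprimeTorus_of_wall (hw : w ∉ S') (hsp : w ∈ splitChartPlaces L α) (h : c w 0 = c w 2) :
    gprimeTorus L α S' c = gprimeTorus L α (insert w S') (Function.update c w ![0, c w 1, c w 0]) := by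
  unfold gprimeTorus
  congr 1
  funext v
  by_cases hv : v = w
  · subst hv
    apply Subtype.ext
    rw [coe_gprimeBlock_of_not_mem L α c hw, coe_gprimeBlock_of_mem L α _ (Finset.mem_insert_self v S') hsp]
    have hc : c v = ![c v 0, c v 1, c v 0] := by funext k; fin_cases k; exacts [rfl, rfl, h.symm]
    refine Matrix.GeneralLinearGroup.ext fun i j => ?_
    rw [coe_gprimeSplitGL, Function.update_self, gprimeSplitMatrix_zero, ← hc]
  · have hiff : (v ∈ insert w S' ∧ v ∈ splitChartPlaces L α) ↔ (v ∈ S' ∧ v ∈ splitChartPlaces L α) := by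
      simp [Finset.mem_insert, hv]
    apply Subtype.ext
    unfold gprimeBlock
    simp only [Function.update_of_ne hv]
    by_cases hc : v ∈ S' ∧ v ∈ splitChartPlaces L α
    · rw [dif_pos hc, dif_pos (hiff.2 hc)]
    · rw [dif_neg hc, dif_neg (fun h' => hc (hiff.1 h'))]

end Charts

end Literature.NumberTheory.Automorphic.UnitaryGroup

end
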